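import Summits.QuantumFields.YangMills.Theorems.LuscherReductionTwistedTraceScalingBOStiffTailFarRecord
import Summits.QuantumFields.YangMills.Theorems.LuscherReductionTwistedTraceScalingBOStiffAssembly
import HarnessLib

/-!
# (B-ST) step (B), THE TWO TAILS OF RECORD IN THE LITERAL SHAPE OF `hST_of_pieces`: `hfar` / `hshell` with `S₂ = {β^{-1}ℓ < ‖P_Γ relLinkVec‖}`, `S₃ = {r_f/2 < ‖relLinkVec‖}`, `a₂ = a₃ = a·Λ`
# (lane A of S-BASE, crux `TwistedTraceScaling` stmt-QuantumFields-20203, C4-CORE, the (B-ST) pen; design card `pub/ym-fleet/ym-luscher-20007-p1/Lines-BST-poincare.md` (B); HANDOFF-g21 UPDATE 19:05Z (W1-1/2))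

The lead's top-level assembly `…BOStiffAssembly.hST_of_pieces` takes, for measurable cut sets `S₂` (gauge-far) and `S₃` (stiff shell) and rates `a₂, a₃`, the piece bounds
`hfar : Q(P₀(𝟙_{S₂}v)) ≤ a₂·‖v‖²_w` and `hshell : Q(P₀(𝟙_{S₃∖S₂}v)) ≤ a₃·‖v‖²_w` for every admissible `v` (measurable, bounded, supported in `{χ ≠ 0}`, `Adm v`).  This file delivers them for
the record data, from `…BOStiffTailFarRecord.eventually_qform_basedAvg_far_record` and `…BOStiffTailShellRecord.eventually_qform_basedAvg_shell_record`, with the cut sets of record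
  `S₂(β) = {U | β^{-1}ℓ < ‖P_Γ(relLinkVec U)‖}`,  `S₃(β) = {U | r_f(β)/2 < ‖relLinkVec U‖}`  (`r_f = min(1/40, β^{-1/2}ℓ)`, `ℓ = btLog β`; both measurable: `measurableSet_far_record`,
`measurableSet_shell_record`) and `a₂ = a₃ = a·Λ(β)` for ANY `a > 0` (`Λ` the literal currency of `…BORecordInputOfST.recordAnalyticInput_of_hST`; the lead takes `a = ε` with `16ε ≤ θ₀²` in
`pieces_budget`):
* ★★★ `hfar_record` — `∃ M₀ ≥ 2, ∀ M ≥ M₀, ∀ a > 0, ∀ᶠ β, ∀ Adm, ∀ v …, Q(P₀(𝟙_{S₂(β)}v)) ≤ (a·Λ(β))·tubeNormSq (softWeight (recordChi L s 43 M β)) v` (`0 < s ≤ 1/3`);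
* ★★★ `hshell_record` — `∀ M ≥ 0, ∀ a > 0, ∀ᶠ β, ∀ Adm, ∀ v …, Q(P₀(𝟙_{S₃(β)∖S₂(β)}v)) ≤ (a·Λ(β))·tubeNormSq (softWeight (recordChi L s 43 M β)) v` (`s > 0`, `L ≥ 2`);
  the admissibility predicate `Adm` is arbitrary (the tails do not use the fibre orthogonality), so the lead's `hST_of_pieces` consumes these by `exact`.
* `tubeNormSq_indicator_le` — `‖𝟙_S v‖²_w ≤ ‖v‖²_w` for bounded measurable `v`, any `S`, and the record weight.
HONEST FRAMING: bookkeeping for a stub of a child of the CONDITIONAL route R2b1; (B-ST) OPEN; C4-CORE OPEN; not infinite volume, not a gap, not Clay.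
-/

set_option autoImplicit false

noncomputable section

open MeasureTheory Filter Topology Real
open scoped BigOperators
open Literature.MathematicalPhysics.QuantumFieldTheory
open Literature.MathematicalPhysics.QuantumLattice

namespace Summit.QuantumFields.YangMills.Theorems.FemtoTransferGap.TwoLattice.ConstTube

open Summit.QuantumFields.YangMills.Theorems.FemtoTransferGap
open Summit.QuantumFields.YangMills.Theorems.FemtoTransferGap.TwoLattice
open Summit.QuantumFields.YangMills.Theorems.FemtoTransferGap.TwoLattice.Avg
open Summit.QuantumFields.YangMills.Theorems.FemtoTransferGap.TwoLattice.Stiff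
open Summit.QuantumFields.YangMills.Theorems.FemtoTransferGap.TwoLattice.GnChart
open Summit.QuantumFields.YangMills.Theorems.FemtoTransferGap.TwoLattice.Cov

variable {L : ℕ} [NeZero L]

/-! ## §1 The cut sets of record are measurable; indicator pieces have smaller weighted norm -/

/-- The gauge-far cut `S₂(β) = {U | τ < ‖P_Γ(relLinkVec U)‖}` is measurable. [folklore] -/
theorem measurableSet_far_record (τ : ℝ) : MeasurableSet {U : GaugeConfig 3 L SU2 | τ < ‖(gaugeModes L).starProjection (relLinkVec L U)‖} :=
  measurableSet_lt measurable_const ((gaugeModes L).starProjection.continuous.norm.measurable.comp (measurable_relLinkVec L))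

/-- The stiff-shell cut `S₃(β) = {U | R < ‖relLinkVec U‖}` is measurable. [folklore] -/
theorem measurableSet_shell_record (R : ℝ) : MeasurableSet {U : GaugeConfig 3 L SU2 | R < ‖relLinkVec L U‖} :=
  measurableSet_lt measurable_const (measurable_relLinkVec L).norm

/-- `‖𝟙_S v‖²_w ≤ ‖v‖²_w` for bounded measurable `v`, any set `S`, `w` the soft weight of record (bounded measurable, `≥ 0`). [folklore] -/
theorem tubeNormSq_indicator_le (s K M β : ℝ) {v : GaugeConfig 3 L SU2 → ℝ} (hv : Measurable v) {Cv : ℝ} (hCv : ∀ U, |v U| ≤ Cv) (S : Set (GaugeConfig 3 L SU2)) :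
    tubeNormSq (softWeight (recordChi L s K M β)) (S.indicator v) ≤ tubeNormSq (softWeight (recordChi L s K M β)) v := by
  obtain ⟨hwm, hwb, hw0, -⟩ := softWeight_recordChi_props (L := L) s K M β
  unfold tubeNormSq
  refine integral_mono_of_nonneg (ae_of_all _ fun U => mul_nonneg (sq_nonneg _) (hw0 U)) ?_ (ae_of_all _ fun U => ?_)
  · exact integrable_of_measurable_abs_le _ ((hv.pow_const 2).mul hwm) (C := Cv ^ 2 * Real.exp ((Fintype.card (Edge 3 L) : ℝ) / powScale 1 β ^ 2)) fun U => by
      rw [abs_mul, abs_pow]; exact mul_le_mul (pow_le_pow_left₀ (abs_nonneg _) (hCv U) 2) (hwb U) (abs_nonneg _) (sq_nonneg _)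
  · show S.indicator v U ^ 2 * softWeight (recordChi L s K M β) U ≤ v U ^ 2 * softWeight (recordChi L s K M β) U
    by_cases hU : U ∈ S
    · rw [Set.indicator_of_mem hU]
    · rw [Set.indicator_of_notMem hU]; nlinarith [hw0 U, sq_nonneg (v U)]

/-! ## §2 ★★★ `hfar` of record -/

set_option maxHeartbeats 800000 in
-- long record expressions.
/-- ★★★ **`hfar` OF RECORD, in the literal shape of `hST_of_pieces`** (`S₂(β) = {β^{-1}ℓ < ‖P_Γ relLinkVec‖}`, `a₂ = a·Λ(β)`): for `L` with a non-zero site and `0 < s ≤ 1/3` there is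
`M₀ ≥ 2` such that for all `M ≥ M₀`, all `a > 0`, eventually in `β`, for every predicate `Adm` and every bounded measurable `v` supported in `{recordChi L s 43 M β ≠ 0}` with `Adm v`,
`Q(P₀(𝟙_{S₂(β)} v)) ≤ (a·Λ(β))·tubeNormSq (softWeight (recordChi L s 43 M β)) v`. [cite: Luscher1983, §3] [cite: SeilerLNP1982, §2] -/
theorem hfar_record (hLz : Nonempty (NzSite L)) {s : ℝ} (hs : 0 < s) (hs3 : s ≤ 1 / 3) :
    ∃ M₀ : ℝ, 2 ≤ M₀ ∧ ∀ M : ℝ, M₀ ≤ M → ∀ a : ℝ, 0 < a → ∀ᶠ β : ℝ in atTop, ∀ Adm : (GaugeConfig 3 L SU2 → ℝ) → Prop,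
      ∀ v : GaugeConfig 3 L SU2 → ℝ, Measurable v → (∃ C : ℝ, ∀ U, |v U| ≤ C) → (∀ U, v U ≠ 0 → recordChi L s 43 M β U ≠ 0) → Adm v →
        qform su2Rep β
            (fun U => ∫ h, {U : GaugeConfig 3 L SU2 | powScale 1 β * btLog β < ‖(gaugeModes L).starProjection (relLinkVec L U)‖}.indicator v (gaugeTransform (basedExt L h) U)
              ∂basedMeasure L)
            (fun U => ∫ h, {U : GaugeConfig 3 L SU2 | powScale 1 β * btLog β < ‖(gaugeModes L).starProjection (relLinkVec L U)‖}.indicator v (gaugeTransform (basedExt L h) U)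
              ∂basedMeasure L) ≤
          a * (btC L β (fun x : LinkSpace L => {x : LinkSpace L | linkCurry x ∈ capBalancedSet L}.indicator (fun _ => (1 : ℝ)) x * frozenProfile L (fun β' => stiffGaussExp L (β' / 2) β') (fun β' => min (1 / 40) (powScale (1 / 2) β' * btLog β')) β x) (btEps β) (5 * (powScale (1 / 2) β * btLog β ^ 2)) / fpZ (btEps β) / recordGamma L (fun β' => fun x : LinkSpace L => {x : LinkSpace L | linkCurry x ∈ capBalancedSet L}.indicator (fun _ => (1 : ℝ)) x * frozenProfile L (fun β'' => stiffGaussExp L (β'' / 2) β'') (fun β'' => min (1 / 40) (powScale (1 / 2) β'' * btLog β'')) β' x) β *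
            levelValue su2Rep 1 ((L : ℝ) ^ 3 * β) 0) * tubeNormSq (softWeight (recordChi L s 43 M β)) v := by
  obtain ⟨M₀, hM₀, H⟩ := eventually_qform_basedAvg_far_record (L := L) hLz hs hs3
  refine ⟨M₀, hM₀, fun M hM a ha => ?_⟩
  filter_upwards [H M hM a ha] with β hβ Adm v hv hC hsupp _
  obtain ⟨Cv, hCv⟩ := hC
  exact hβ v hv Cv hCv hsupp

/-! ## §3 ★★★ `hshell` of record -/

set_option maxHeartbeats 800000 in
-- long record expressions.
/-- ★★★ **`hshell` OF RECORD, in the literal shape of `hST_of_pieces`** (`S₃(β) = {r_f/2 < ‖relLinkVec‖}`, `S₂(β)` as in `hfar_record`, `a₃ = a·Λ(β)`): for `L ≥ 2`, `s > 0`, every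
`M ≥ 0` and every `a > 0`, eventually in `β`, for every predicate `Adm` and every bounded measurable `v` supported in `{recordChi L s 43 M β ≠ 0}` with `Adm v`,
`Q(P₀(𝟙_{S₃(β)∖S₂(β)} v)) ≤ (a·Λ(β))·tubeNormSq (softWeight (recordChi L s 43 M β)) v`. [cite: Luscher1983, §3] [cite: SeilerLNP1982, §3] -/
theorem hshell_record (hL : 2 ≤ L) {s : ℝ} (hs : 0 < s) {M : ℝ} (hM : 0 ≤ M) {a : ℝ} (ha : 0 < a) :
    ∀ᶠ β : ℝ in atTop, ∀ Adm : (GaugeConfig 3 L SU2 → ℝ) → Prop,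
      ∀ v : GaugeConfig 3 L SU2 → ℝ, Measurable v → (∃ C : ℝ, ∀ U, |v U| ≤ C) → (∀ U, v U ≠ 0 → recordChi L s 43 M β U ≠ 0) → Adm v →
        qform su2Rep β
            (fun U => ∫ h, ({U : GaugeConfig 3 L SU2 | min (1 / 40) (powScale (1 / 2) β * btLog β) / 2 < ‖relLinkVec L U‖} \
                {U : GaugeConfig 3 L SU2 | powScale 1 β * btLog β < ‖(gaugeModes L).starProjection (relLinkVec L U)‖}).indicator v (gaugeTransform (basedExt L h) U) ∂basedMeasure L)
            (fun U => ∫ h, ({U : GaugeConfig 3 L SU2 | min (1 / 40) (powScale (1 / 2) β * btLog β) / 2 < ‖relLinkVec L U‖} \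
                {U : GaugeConfig 3 L SU2 | powScale 1 β * btLog β < ‖(gaugeModes L).starProjection (relLinkVec L U)‖}).indicator v (gaugeTransform (basedExt L h) U) ∂basedMeasure L) ≤
          a * (btC L β (fun x : LinkSpace L => {x : LinkSpace L | linkCurry x ∈ capBalancedSet L}.indicator (fun _ => (1 : ℝ)) x * frozenProfile L (fun β' => stiffGaussExp L (β' / 2) β') (fun β' => min (1 / 40) (powScale (1 / 2) β' * btLog β')) β x) (btEps β) (5 * (powScale (1 / 2) β * btLog β ^ 2)) / fpZ (btEps β) / recordGamma L (fun β' => fun x : LinkSpace L => {x : LinkSpace L | linkCurry x ∈ capBalancedSet L}.indicator (fun _ => (1 : ℝ)) x * frozenProfile L (fun β'' => stiffGaussExp L (β'' / 2) β'') (fun β'' => min (1 / 40) (powScale (1 / 2) β'' * btLog β'')) β' x) β *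
            levelValue su2Rep 1 ((L : ℝ) ^ 3 * β) 0) * tubeNormSq (softWeight (recordChi L s 43 M β)) v := by
  obtain ⟨cΛ, K, hcΛ, hfloor⟩ := recordLambda_floor (L := L)
  filter_upwards [eventually_qform_basedAvg_shell_record (L := L) hL hs hM ha, hfloor] with β hβ hΛ Adm v hv hC hsupp _
  obtain ⟨Cv, hCv⟩ := hC
  set S₃ : Set (GaugeConfig 3 L SU2) := {U | min (1 / 40) (powScale (1 / 2) β * btLog β) / 2 < ‖relLinkVec L U‖} with hS₃
  set S₂ : Set (GaugeConfig 3 L SU2) := {U | powScale 1 β * btLog β < ‖(gaugeModes L).starProjection (relLinkVec L U)‖} with hS₂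
  have hmeas : MeasurableSet (S₃ \ S₂) := (measurableSet_shell_record (L := L) _).diff (measurableSet_far_record (L := L) _)
  obtain ⟨hfm, hfb⟩ := indicator_piece_props hv hCv hmeas
  have hfsupp : ∀ U, (S₃ \ S₂).indicator v U ≠ 0 → recordChi L s 43 M β U ≠ 0 ∧ min (1 / 40) (powScale (1 / 2) β * btLog β) / 2 < ‖relLinkVec L U‖ ∧
      ‖(gaugeModes L).starProjection (relLinkVec L U)‖ ≤ powScale 1 β * btLog β := fun U hU => by
    by_cases hmem : U ∈ S₃ \ S₂
    · rw [Set.indicator_of_mem hmem] at hU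
      exact ⟨hsupp U hU, hmem.1, not_lt.mp hmem.2⟩
    · exact absurd (Set.indicator_of_notMem hmem v) hU
  have h := hβ _ hfm Cv hfb hfsupp
  -- the currency is nonnegative (floor), so the weighted norm of the piece may be replaced by that of `v`
  have hΛ0 : 0 ≤ btC L β (fun x : LinkSpace L => {x : LinkSpace L | linkCurry x ∈ capBalancedSet L}.indicator (fun _ => (1 : ℝ)) x * frozenProfile L (fun β' => stiffGaussExp L (β' / 2) β') (fun β' => min (1 / 40) (powScale (1 / 2) β' * btLog β')) β x) (btEps β) (5 * (powScale (1 / 2) β * btLog β ^ 2)) / fpZ (btEps β) / recordGamma L (fun β' => fun x : LinkSpace L => {x : LinkSpace L | linkCurry x ∈ capBalancedSet L}.indicator (fun _ => (1 : ℝ)) x * frozenProfile L (fun β'' => stiffGaussExp L (β'' / 2) β'') (fun β'' => min (1 / 40) (powScale (1 / 2) β'' * btLog β'')) β' x) β *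
      levelValue su2Rep 1 ((L : ℝ) ^ 3 * β) 0 :=
    le_trans (mul_pos (mul_pos hcΛ (pow_pos (powScale_pos 1 β) K)) (pow_pos (Real.exp_pos _) _)).le hΛ
  exact h.trans (mul_le_mul_of_nonneg_left (tubeNormSq_indicator_le s 43 M β hv hCv (S₃ \ S₂)) (mul_nonneg ha.le hΛ0))

end Summit.QuantumFields.YangMills.Theorems.FemtoTransferGap.TwoLattice.ConstTube

end
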